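import Literature.NumberTheory.LFunctions.SmoothedExplicitFormulaContour
import Literature.NumberTheory.LFunctions.WeilZeroSum
import Literature.NumberTheory.LFunctions.LogDerivOneSidedBounds
import Literature.NumberTheory.LFunctions.DHTestFunctionBounds
import Literature.NumberTheory.LFunctions.DHCharInequality
import HarnessLib

/-!
# The Deuring–Heilbronn inequality for `K_f(s)` (`ζ` side; Heath-Brown 1992, Lemma 5.3 + Lemma 3.1)

Topic `Literature/NumberTheory/LFunctions`, sub-namespace `DHTest`. Everything here is PROVED;
`nearZerosZeta` is glue (the non-trivial zeros of `ζ` within `δ` of `1 + it`).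

Heath-Brown 1992, **Lemma 5.3** (`χ = χ₀`): `K(s, χ₀) = L F(−L δ) + O(·)`, `s = 1 + δ + it` — the pole
of `ζ` contributes `F((s−1)L)`; combined with Lemma 3.1 for `ζ` exactly as in
`DHCharInequality.lean`. For the test function `g = testFn x₀ ε₂ ε₀ L α`, `1 < σ₀ ≤ 5/4`,
`0 < δ ≤ 1/4`, `s = σ₀ + it` and `T = nearZerosZeta t δ` we prove (`re_fordK_le`)

`Re K_g(s) ≤ L Re H((s−1)L − α) − Σ_{ρ∈T} m(ρ) L Re H((s−ρ)L − α)
   + h(0)(0.861 (log(2/(σ₀−1)) + log(1/(σ₀−1)) + log(|t|+3) + log 21 + 2 log(|t|+4))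
     + (Σ_{ρ∈T} m(ρ))(σ₀ − 1 + δ)/0.74²) + ‖Σ_{ρ∉T} m(ρ) F₀(s−ρ)‖ + ‖J(s)‖`,

from the tree's exact formula `SmoothedEF.fordK_eq_explicit` (Ford 2002 Lemma 4.5) and
`JensenCarlemanBounds.neg_re_logDeriv_riemannZeta_le`; the pole terms combine as
`h(0) Re 1/(s−1) + Re F₀(s−1) = L Re H((s−1)L − α)`.

## References

* D. R. Heath-Brown, Proc. London Math. Soc. (3) 64 (1992), Lemma 3.1, Lemma 5.3, §6.
  [cite: HeathBrown1992PLMS, Lemma 5.3]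
-/

noncomputable section

open Complex Real MeasureTheory Set Filter Topology Metric

namespace Literature.NumberTheory.LFunctions

namespace DHTest

open LaplaceShape JensenCarlemanBounds

/-- The non-trivial zeros of `ζ` within `δ` of `1 + it`, as a finite set of the index type.
[cite: HeathBrown1992PLMS, Lemma 3.1 ((3.7))] -/
def nearZerosZeta (t δ : ℝ) : Finset RHWave0.riemannZetaNontrivialZeros :=
  (weilZeroFinset (|t| + δ)).filter (fun ρ ↦ ‖(ρ : ℂ) - (1 + t * I)‖ ≤ δ)

/-- Membership in `nearZerosZeta`. [folklore] -/
theorem mem_nearZerosZeta {t δ : ℝ} {ρ : RHWave0.riemannZetaNontrivialZeros} :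
    ρ ∈ nearZerosZeta t δ ↔ ‖(ρ : ℂ) - (1 + t * I)‖ ≤ δ := by
  rw [nearZerosZeta, Finset.mem_filter]
  constructor
  · exact fun h ↦ h.2
  · intro h
    refine ⟨?_, h⟩
    have him : |(ρ : ℂ).im - t| ≤ δ := by
      have := Complex.abs_im_le_norm ((ρ : ℂ) - (1 + t * I))
      simp at this
      exact this.trans h
    have := abs_sub_abs_le_abs_sub (ρ : ℂ).im t
    exact (mem_weilZeroFinset (ρ := ρ)).2 (by linarith)

/-- A near zero has `1 − δ ≤ Re ρ`. [folklore] -/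
theorem re_ge_of_mem_nearZerosZeta {t δ : ℝ} {ρ : RHWave0.riemannZetaNontrivialZeros}
    (hρ : ρ ∈ nearZerosZeta t δ) : 1 - δ ≤ (ρ : ℂ).re := by
  have h := mem_nearZerosZeta.1 hρ
  have := Complex.abs_re_le_norm ((ρ : ℂ) - (1 + t * I))
  simp at this
  have := this.trans h
  linarith [abs_le.1 this]

/-- A near zero lies within `δ + (σ₀ − 1)` of `s = σ₀ + it`. [folklore] -/
theorem norm_sub_le_of_mem_nearZerosZeta {t δ σ₀ : ℝ} (hσ₀ : 1 ≤ σ₀)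
    {ρ : RHWave0.riemannZetaNontrivialZeros} (hρ : ρ ∈ nearZerosZeta t δ) :
    ‖(ρ : ℂ) - (σ₀ + t * I)‖ ≤ δ + (σ₀ - 1) := by
  have h := mem_nearZerosZeta.1 hρ
  have e : (ρ : ℂ) - (σ₀ + t * I) = ((ρ : ℂ) - (1 + t * I)) - ((σ₀ - 1 : ℝ) : ℂ) := by
    push_cast; ring
  rw [e]
  refine (norm_sub_le _ _).trans ?_
  rw [Complex.norm_real, Real.norm_eq_abs, abs_of_nonneg (by linarith)]
  linarith

/-- A zero-free circle for `ζ` about `s` (`Re s > 1`) with radius in `[0.74, 0.75]`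
(applied to the entire `ζ₁ = (s−1)ζ(s)`; `ζ(1) ≠ 0` in Mathlib's convention). [folklore] -/
theorem exists_radius_sphere_riemannZeta_ne_zero {s : ℂ} (hs : 1 < s.re) :
    ∃ R ∈ Icc (0.74 : ℝ) 0.75, ∀ z ∈ sphere s R, riemannZeta z ≠ 0 := by
  have hs1 : s ≠ 1 := fun h ↦ by rw [h, Complex.one_re] at hs; exact lt_irrefl _ hs
  have hζs : riemannZeta s ≠ 0 := riemannZeta_ne_zero_of_one_lt_re hs
  have hζ₁s : riemannZeta₁ s ≠ 0 := fun h ↦ hζs ((riemannZeta₁_eq_zero_iff hs1).1 h)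
  have han : AnalyticOnNhd ℂ riemannZeta₁ (closedBall s 0.75) := fun z _ ↦
    differentiable_riemannZeta₁.analyticAt z
  obtain ⟨R, hR, hsph⟩ := exists_radius_sphere_ne_zero (R₁ := 0.74) (R₂ := 0.75) (by norm_num)
    (by norm_num) han hζ₁s
  refine ⟨R, hR, fun z hz ↦ ?_⟩
  by_cases hz1 : z = 1
  · rw [hz1]; exact riemannZeta_one_ne_zero
  · exact fun h ↦ hsph z hz ((riemannZeta₁_eq_zero_iff hz1).2 h)

/-- **Heath-Brown's Lemma 5.3 + Lemma 3.1 for `ζ`** (the `χ₀` analogue of `re_charFordK_le`, with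
the pole terms `h(0) Re 1/(s−1) + Re F₀(s−1) = L Re H((s−1)L − α)`): for `g = testFn x₀ ε₂ ε₀ L α`,
`1 < σ₀ ≤ 5/4`, `0 < δ ≤ 1/4`, `s = σ₀ + it`, `T = nearZerosZeta t δ`,
`Re K_g(s) ≤ L Re H((s−1)L − α) − Σ_{ρ∈T} m(ρ) L Re H((s−ρ)L − α)
  + h(0)(0.861(log(2/(σ₀−1)) + log(1/(σ₀−1)) + log(|t|+3) + log 21 + 2 log(|t|+4))
    + (Σ_{ρ∈T} m(ρ))(σ₀−1+δ)/0.74²) + ‖Σ_{ρ∉T} m F₀(s−ρ)‖ + ‖J(s)‖`.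
[cite: HeathBrown1992PLMS, Lemma 5.3] -/
theorem re_fordK_le {x₀ ε₂ ε₀ L α : ℝ} (hε : 0 < ε₂) (hεx : ε₂ ≤ x₀) (hL : 0 < L)
    {σ₀ t δ : ℝ} (hσ₀ : 1 < σ₀) (hσ₀' : σ₀ ≤ 5 / 4) (hδ' : δ ≤ 1 / 4) :
    let s : ℂ := (σ₀ : ℂ) + t * I
    let g := testFn x₀ ε₂ ε₀ L α
    let T := nearZerosZeta t δ
    (fordK g s).re ≤
      L * (shapeLaplace (shape x₀ ε₂ ε₀) x₀ ((s - 1) * L - α)).re -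
        (∑ ρ ∈ T, (riemannZetaZeroOrder (ρ : ℂ) : ℝ) *
          (L * (shapeLaplace (shape x₀ ε₂ ε₀) x₀ ((s - ρ) * L - α)).re)) +
        shape x₀ ε₂ ε₀ 0 * (0.861 * (Real.log (2 / (σ₀ - 1)) + Real.log (1 / (σ₀ - 1)) +
          Real.log (|t| + 3) + Real.log 21 + 2 * Real.log (|t| + 4)) +
          (∑ ρ ∈ T, (riemannZetaZeroOrder (ρ : ℂ) : ℝ)) * ((σ₀ - 1 + δ) / 0.74 ^ 2)) +
        ‖∑' ρ : ↑((T : Set RHWave0.riemannZetaNontrivialZeros)ᶜ),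
            (riemannZetaZeroOrder ((ρ : RHWave0.riemannZetaNontrivialZeros) : ℂ) : ℂ) *
              fordLaplace₀ g (s - (ρ : RHWave0.riemannZetaNontrivialZeros))‖ +
        ‖smoothedEFRemainder g s‖ := by
  intro s g T
  have hx₀ : 0 ≤ x₀ := hε.le.trans hεx
  set h := shape x₀ ε₂ ε₀ with hh
  set H := shapeLaplace h x₀ with hH
  set m : ℂ → ℤ := riemannZetaZeroOrder with hm
  have hsre : s.re = σ₀ := by simp [s]
  have hsim : s.im = t := by simp [s]
  have hs1 : s ≠ 1 := fun h' ↦ by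
    have := congrArg Complex.re h'; rw [hsre, Complex.one_re] at this; linarith
  have hζs : riemannZeta s ≠ 0 := riemannZeta_ne_zero_of_one_lt_re (by rw [hsre]; exact hσ₀)
  have htest := isSmoothedEFTest_testFn (ε₀ := ε₀) (α := α) hx₀ hε hL
  -- (1) the exact explicit formula
  have hEF := SmoothedEF.fordK_eq_explicit htest (s := s) (by rw [hsre]; linarith) (by rw [hsre]; linarith) hs1 hζs
  have hsum := (SmoothedEF.summable_norm_zeroTerm htest (s := s) (by rw [hsre]; linarith) hζs).of_norm
  have hsplit := hsum.sum_add_tsum_compl (s := T)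
  set Sfar := ∑' ρ : ↑((T : Set RHWave0.riemannZetaNontrivialZeros)ᶜ),
    (m ((ρ : RHWave0.riemannZetaNontrivialZeros) : ℂ) : ℂ) *
      fordLaplace₀ g (s - (ρ : RHWave0.riemannZetaNontrivialZeros)) with hSfar
  set J := smoothedEFRemainder g s with hJ
  have hK : fordK g s = -(g 0 : ℂ) * (deriv riemannZeta s / riemannZeta s) + fordLaplace₀ g (s - 1) -
      (∑ ρ ∈ T, (m (ρ : ℂ) : ℂ) * fordLaplace₀ g (s - ρ) + Sfar) + J := by
    rw [hEF, ← hsplit]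
  -- (2) Lemma 3.1 at `s`
  obtain ⟨R, hRmem, hRsph⟩ := exists_radius_sphere_riemannZeta_ne_zero (s := s) (by rw [hsre]; exact hσ₀)
  have hR1 : 0.74 ≤ R := hRmem.1
  have hR2 : R ≤ 0.75 := hRmem.2
  classical
  set Tc : Finset ℂ := T.image Subtype.val with hTc
  have hTcP : ∀ ρ ∈ Tc, riemannZeta ρ = 0 ∧ ‖ρ - (σ₀ + t * I)‖ ≤ R := by
    intro ρ hρ
    obtain ⟨ρ', hρ', rfl⟩ := Finset.mem_image.1 hρ
    refine ⟨ZetaZeros.riemannZetaNontrivialZeros.zeta_eq_zero ρ'.2,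
      (norm_sub_le_of_mem_nearZerosZeta hσ₀.le hρ').trans ?_⟩
    linarith
  have hL31 := neg_re_logDeriv_riemannZeta_le hσ₀ hσ₀' (by linarith) (by linarith) hRsph Tc hTcP
  rw [hTc, Finset.sum_image (fun a _ b _ hab ↦ Subtype.ext hab)] at hL31
  -- (3) real parts
  have hg0 : g 0 = h 0 := by simp only [g, hh]; rw [testFn_zero, shape_zero]
  have h0nn : 0 ≤ h 0 := by rw [hh]; exact shape_nonneg hε 0
  have hre : (fordK g s).re = -(h 0) * (deriv riemannZeta s / riemannZeta s).re +
      (fordLaplace₀ g (s - 1)).re -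
      (∑ ρ ∈ T, ((m (ρ : ℂ) : ℂ) * fordLaplace₀ g (s - ρ)).re) - Sfar.re + J.re := by
    rw [hK]
    simp only [Complex.sub_re, Complex.add_re, Complex.neg_re, Complex.neg_im, Complex.mul_re,
      Complex.re_sum, Complex.ofReal_re, Complex.ofReal_im, Complex.intCast_re, Complex.intCast_im,
      neg_zero, zero_mul, sub_zero, hg0]
    ring
  rw [hre]
  have hθ := two_div_pi_mul_le hR1
  set E : ℝ := Real.log (2 / (σ₀ - 1)) + Real.log (1 / (σ₀ - 1)) + Real.log (|t| + 3) + Real.log 21 +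
    2 * Real.log (|t| + 4) with hEdef
  have hE0 : 0 ≤ E := by
    have h1 : 0 ≤ Real.log (2 / (σ₀ - 1)) := Real.log_nonneg (by rw [le_div_iff₀ (by linarith)]; linarith)
    have h2 : 0 ≤ Real.log (1 / (σ₀ - 1)) := Real.log_nonneg (by rw [le_div_iff₀ (by linarith)]; linarith)
    have h3 : 0 ≤ Real.log (|t| + 3) := Real.log_nonneg (by linarith [abs_nonneg t])
    have h4 : 0 ≤ Real.log 21 := Real.log_nonneg (by norm_num)
    have h5 : 0 ≤ Real.log (|t| + 4) := Real.log_nonneg (by linarith [abs_nonneg t])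
    rw [hEdef]; positivity
  have hmain : -(h 0) * (deriv riemannZeta s / riemannZeta s).re ≤
      h 0 * (1 / (s - 1)).re -
        h 0 * (∑ ρ ∈ T, (m (ρ : ℂ) : ℝ) * (1 / (s - ρ) + ((ρ : ℂ) - s) / (R : ℂ) ^ 2).re) +
        h 0 * (0.861 * E) := by
    have h1 : -(h 0) * (deriv riemannZeta s / riemannZeta s).re =
        h 0 * (-(deriv riemannZeta s / riemannZeta s).re) := by ring
    rw [h1]
    refine (mul_le_mul_of_nonneg_left hL31 h0nn).trans ?_
    have h2 : 2 * ((Real.log (2 / (σ₀ - 1)) + Real.log (1 / (σ₀ - 1)) + Real.log (|t| + 3)) +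
        (Real.log 21 + 2 * Real.log (|t| + 4))) / (π * R) ≤ 0.861 * E := by
      rw [show 2 * ((Real.log (2 / (σ₀ - 1)) + Real.log (1 / (σ₀ - 1)) + Real.log (|t| + 3)) +
        (Real.log 21 + 2 * Real.log (|t| + 4))) / (π * R) = 2 / (π * R) * E by rw [hEdef]; ring]
      exact mul_le_mul_of_nonneg_right hθ hE0
    nlinarith
  -- (4) the pole terms combine
  have hpole := cancel_identity (ε₀ := ε₀) (α := α) hx₀ hε hL (s - 1)
  -- (5) the near-zero terms
  have hnear : ∀ ρ ∈ T, -(h 0) * ((m (ρ : ℂ) : ℝ) * (1 / (s - ρ) + ((ρ : ℂ) - s) / (R : ℂ) ^ 2).re) -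
      ((m (ρ : ℂ) : ℂ) * fordLaplace₀ g (s - ρ)).re ≤
      -((m (ρ : ℂ) : ℝ) * (L * (H ((s - ρ) * L - α)).re)) +
        h 0 * ((m (ρ : ℂ) : ℝ) * ((σ₀ - 1 + δ) / 0.74 ^ 2)) := by
    intro ρ hρ
    have hρre := re_ge_of_mem_nearZerosZeta hρ
    have hρ1 : (ρ : ℂ).re < 1 := ZetaZeros.riemannZetaNontrivialZeros.re_lt_one ρ.2
    have hcancel := cancel_identity (ε₀ := ε₀) (α := α) hx₀ hε hL (s - ρ)
    have hmre : ((m (ρ : ℂ) : ℂ) * fordLaplace₀ g (s - ρ)).re = (m (ρ : ℂ) : ℝ) * (fordLaplace₀ g (s - ρ)).re := by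
      rw [show ((m (ρ : ℂ) : ℤ) : ℂ) = ((m (ρ : ℂ) : ℝ) : ℂ) by simp, Complex.re_ofReal_mul]
    rw [hmre, Complex.add_re]
    have hR2re : (((ρ : ℂ) - s) / (R : ℂ) ^ 2).re = ((ρ : ℂ).re - σ₀) / R ^ 2 := by
      rw [show ((R : ℂ) ^ 2) = ((R ^ 2 : ℝ) : ℂ) by push_cast; ring, Complex.div_ofReal_re, Complex.sub_re, hsre]
    have hterm : -(((ρ : ℂ).re - σ₀) / R ^ 2) ≤ (σ₀ - 1 + δ) / 0.74 ^ 2 := by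
      rw [← neg_div, neg_sub]
      have hnum : σ₀ - (ρ : ℂ).re ≤ σ₀ - 1 + δ := by linarith
      have hnum0 : 0 ≤ σ₀ - (ρ : ℂ).re := by linarith
      calc (σ₀ - (ρ : ℂ).re) / R ^ 2 ≤ (σ₀ - (ρ : ℂ).re) / 0.74 ^ 2 :=
            div_le_div_of_nonneg_left hnum0 (by norm_num) (by nlinarith)
        _ ≤ (σ₀ - 1 + δ) / 0.74 ^ 2 := div_le_div_of_nonneg_right hnum (by norm_num)
    have hm0 : (0 : ℝ) ≤ m (ρ : ℂ) := ZetaZeroSum.zeroOrder_nonneg ρ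
    have key : -(h 0) * ((m (ρ : ℂ) : ℝ) * ((1 / (s - (ρ : ℂ))).re + (((ρ : ℂ) - s) / (R : ℂ) ^ 2).re)) -
        (m (ρ : ℂ) : ℝ) * (fordLaplace₀ g (s - ρ)).re =
        -((m (ρ : ℂ) : ℝ) * (h 0 * (1 / (s - (ρ : ℂ))).re + (fordLaplace₀ g (s - ρ)).re)) +
          h 0 * ((m (ρ : ℂ) : ℝ) * (-((((ρ : ℂ) - s) / (R : ℂ) ^ 2).re))) := by ring
    rw [key, hcancel, hR2re]
    have : h 0 * ((m (ρ : ℂ) : ℝ) * -(((ρ : ℂ).re - σ₀) / R ^ 2)) ≤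
        h 0 * ((m (ρ : ℂ) : ℝ) * ((σ₀ - 1 + δ) / 0.74 ^ 2)) :=
      mul_le_mul_of_nonneg_left (mul_le_mul_of_nonneg_left hterm hm0) h0nn
    linarith
  have e1 : -(h 0) * (∑ ρ ∈ T, (m (ρ : ℂ) : ℝ) * (1 / (s - ρ) + ((ρ : ℂ) - s) / (R : ℂ) ^ 2).re) -
      ∑ ρ ∈ T, ((m (ρ : ℂ) : ℂ) * fordLaplace₀ g (s - ρ)).re =
      ∑ ρ ∈ T, (-(h 0) * ((m (ρ : ℂ) : ℝ) * (1 / (s - ρ) + ((ρ : ℂ) - s) / (R : ℂ) ^ 2).re) -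
        ((m (ρ : ℂ) : ℂ) * fordLaplace₀ g (s - ρ)).re) := by
    rw [Finset.sum_sub_distrib, Finset.mul_sum]
  have e2 : ∑ ρ ∈ T, (-((m (ρ : ℂ) : ℝ) * (L * (H ((s - ρ) * L - α)).re)) +
        h 0 * ((m (ρ : ℂ) : ℝ) * ((σ₀ - 1 + δ) / 0.74 ^ 2))) =
      -(∑ ρ ∈ T, (m (ρ : ℂ) : ℝ) * (L * (H ((s - ρ) * L - α)).re)) +
        h 0 * ((∑ ρ ∈ T, (m (ρ : ℂ) : ℝ)) * ((σ₀ - 1 + δ) / 0.74 ^ 2)) := by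
    rw [Finset.sum_add_distrib, Finset.sum_neg_distrib, ← Finset.mul_sum, ← Finset.sum_mul]
  have hS : -Sfar.re ≤ ‖Sfar‖ := (neg_le_abs _).trans (Complex.abs_re_le_norm _)
  have hJ' : J.re ≤ ‖J‖ := (le_abs_self _).trans (Complex.abs_re_le_norm _)
  have hsumle : ∑ ρ ∈ T, (-(h 0) * ((m (ρ : ℂ) : ℝ) * (1 / (s - ρ) + ((ρ : ℂ) - s) / (R : ℂ) ^ 2).re) -
        ((m (ρ : ℂ) : ℂ) * fordLaplace₀ g (s - ρ)).re) ≤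
      ∑ ρ ∈ T, (-((m (ρ : ℂ) : ℝ) * (L * (H ((s - ρ) * L - α)).re)) +
        h 0 * ((m (ρ : ℂ) : ℝ) * ((σ₀ - 1 + δ) / 0.74 ^ 2))) := Finset.sum_le_sum hnear
  rw [e2] at hsumle
  have hpole' : h 0 * (1 / (s - 1)).re + (fordLaplace₀ g (s - 1)).re = L * (H ((s - 1) * L - α)).re := hpole
  linarith [hmain, hsumle, e1, hpole']

end DHTest

end Literature.NumberTheory.LFunctions

end
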